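import Mathlib

/-!
# Strip blocks of `F`: the rank bound `rank F ≤ Σ_k cap_k` and vanishing of junk blocks (package G)

Support file for crux item `stmt-MatrixMultiplication-10752`
(`Summit.MatrixMultiplication.MatrixMultiplication.Theses.HiddenToeplitzCorners.HiddenCornerLemmaR`),
line `frobenius-dual-short-syzygies`, stub `stub_gconstDualLaw` / the strip theorem
(paper proof `math/STRIP_THEOREM.md` §3, steps (G2) and (G3)).

Setting (written out verbatim in every registered statement).  A frame is `e : Fin r → ℂ[X]`
(here the columns of `E` read as polynomials, `polyE c' = Σ_{n<N} E n c' • X^n` via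
`Polynomial.degreeLTEquiv`); `δ := Polynomial.divX`; a coefficient polynomial `α` acts on `f` by
`act α f := Σ_i coeff α i • δ^[i] f` (through `Polynomial.lsum`); the evaluation map is
`Ev α := Σ_c act (α c) (e c)`; the relations of window `w` are `Rel_w := ker Ev ⊓ pi univ degreeLT w`;
the slot space is `S_w := ⨆ b, map (proj b) Rel_w ≤ degreeLT w`, and the capacity of the window is
`cap_w := w − finrank S_w`.

Results (registered helper stubs of the crux):
* `hclR_strip_junk_block_zero` (G3): if the strip block of `F` (rows `c0 + m`, `m < wk`) is
  orthogonal to the coefficient vector of every slot of every relation at window `wk`, and the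
  window is junk (`S_{wk} = degreeLT wk`), then the strip block of `F` vanishes;
* `hclR_strip_rank_le_sum_cap` (G2): if the strips `[cut k, cut (k+1))` cover the rows
  (`cut 0 = 0`, `cut p = N`) and each strip block of `F` is orthogonal to the coefficient vectors of
  the slots of the relations at the strip's window, then `rank F ≤ Σ_k cap_{w_k}`.

Proofs.  Both only use that the annihilator `{q | Σ_m coeff q m * t m = 0}` of a vector `t` is a
submodule of `ℂ[X]` (the kernel of the functional `Σ_m (lcoeff m).smulRight (t m)`), so the
orthogonality hypothesis extends from the slots `α b` to the whole slot space `S`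
(`hclR_stripR_orth_iSup`).  G3: apply this to `q = X^m ∈ degreeLT wk = S`.  G2: (i) every row of
`F` is a row of one of the strip blocks `B_k` (the least `k₁` with `n < cut k₁` is positive and
`n` lies in strip `k₁ - 1`, `hclR_stripR_exists_strip`), so the row space of `F` lies in the
`⨆` of the row spaces of the `B_k` and `rank F ≤ Σ_k rank B_k`
(`hclR_stripR_finrank_iSup_le`, `hclR_stripR_rank_le_sum_blocks`); (ii) for one block,
`rank B + finrank S ≤ w` (`hclR_stripR_block_rank_add_le`): the coefficient map
`π : ℂ[X] → ℂ^w` is injective on `S ≤ degreeLT w`, the map `Φ : ℂ^w → Dual (π S)`,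
`t ↦ (v ↦ t ⬝ᵥ v)`, is surjective (`dotProductEquiv`, `Subspace.dualRestrict_surjective`), so
`finrank (π S) + finrank (ker Φ) = w` by rank–nullity, and the column space of `B` lies in
`ker Φ` — the pattern of `hclR_rows_annihilating_le`.  Folklore linear algebra.
-/

set_option linter.dupNamespace false

namespace Summit.MatrixMultiplication.MatrixMultiplication.Theorems

open Polynomial
open scoped Matrix

/-! ## Helpers -/

/-- The coefficient pairing with a vector `t ∈ ℂ^w` as a linear functional on `ℂ[X]`:
`(Σ_m (lcoeff m).smulRight (t m)) q = Σ_{m<w} coeff q m * t m`. -/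
theorem hclR_stripR_pair_apply {w : ℕ} (t : Fin w → ℂ) (q : ℂ[X]) :
    (∑ m : Fin w, (Polynomial.lcoeff ℂ (m : ℕ)).smulRight (t m)) q =
      ∑ m : Fin w, q.coeff m * t m := by
  rw [LinearMap.sum_apply]
  simp only [LinearMap.smulRight_apply, Polynomial.lcoeff_apply, smul_eq_mul]

/-- Orthogonality extends from the slots to the slot space: if `Σ_m coeff (α b) m * t m = 0` for
every `α ∈ R` and every slot `b`, then `Σ_m coeff q m * t m = 0` for every `q` in
`⨆ b, map (proj b) R` (the annihilator of `t` is the kernel of a linear functional). -/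
theorem hclR_stripR_orth_iSup {r w : ℕ} (R : Submodule ℂ (Fin r → ℂ[X])) (t : Fin w → ℂ)
    (h : ∀ α ∈ R, ∀ b : Fin r, ∑ m : Fin w, (α b).coeff m * t m = 0) :
    ∀ q ∈ ⨆ b : Fin r, Submodule.map (LinearMap.proj b : (Fin r → ℂ[X]) →ₗ[ℂ] ℂ[X]) R,
      ∑ m : Fin w, q.coeff m * t m = 0 := by
  intro q hq
  have hle : (⨆ b : Fin r, Submodule.map (LinearMap.proj b : (Fin r → ℂ[X]) →ₗ[ℂ] ℂ[X]) R) ≤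
      LinearMap.ker (∑ m : Fin w, (Polynomial.lcoeff ℂ (m : ℕ)).smulRight (t m)) := by
    refine iSup_le fun b => ?_
    rintro _ ⟨α, hα, rfl⟩
    rw [LinearMap.mem_ker, hclR_stripR_pair_apply]
    exact h α hα b
  have hq' := hle hq
  rwa [LinearMap.mem_ker, hclR_stripR_pair_apply] at hq'

/-- G3 in abstract form: if `t` is orthogonal to the coefficient vectors of all slots of all
`α ∈ R` and the slot space of `R` is all of `degreeLT w`, then `t = 0` (test against `X^m`). -/
theorem hclR_stripR_junk_aux {r w : ℕ} (R : Submodule ℂ (Fin r → ℂ[X])) (t : Fin w → ℂ)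
    (h : ∀ α ∈ R, ∀ b : Fin r, ∑ m : Fin w, (α b).coeff m * t m = 0)
    (hjunk : (⨆ b : Fin r, Submodule.map (LinearMap.proj b : (Fin r → ℂ[X]) →ₗ[ℂ] ℂ[X]) R) =
      Polynomial.degreeLT ℂ w) (m : Fin w) : t m = 0 := by
  have hX : (X : ℂ[X]) ^ (m : ℕ) ∈ Polynomial.degreeLT ℂ w := by
    rw [Polynomial.mem_degreeLT]
    refine (Polynomial.degree_X_pow_le _).trans_lt ?_
    exact_mod_cast m.2
  rw [← hjunk] at hX
  have h2 := hclR_stripR_orth_iSup R t h _ hX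
  simp only [Polynomial.coeff_X_pow] at h2
  rw [Finset.sum_eq_single m] at h2
  · simpa using h2
  · intro b _ hb
    rw [if_neg (fun h' => hb (Fin.ext h')), zero_mul]
  · intro hm
    exact absurd (Finset.mem_univ m) hm

/-- Block bound (G2 (ii)) in abstract form: if the slot space `S := ⨆ b, map (proj b) R` lies in
`degreeLT w` and every column of `B : Matrix (Fin w) ι ℂ` is orthogonal to the coefficient vectors
of all slots of all `α ∈ R`, then `rank B + finrank S ≤ w`.  The coefficient map `π : ℂ[X] → ℂ^w`
is injective on `S`; `Φ : ℂ^w → Dual (π S)`, `t ↦ (v ↦ t ⬝ᵥ v)`, is onto, so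
`finrank (π S) + finrank (ker Φ) = w`; and the column space of `B` lies in `ker Φ`. -/
theorem hclR_stripR_block_rank_add_le {r w : ℕ} {ι : Type*} [Fintype ι]
    (R : Submodule ℂ (Fin r → ℂ[X]))
    (hR : (⨆ b : Fin r, Submodule.map (LinearMap.proj b : (Fin r → ℂ[X]) →ₗ[ℂ] ℂ[X]) R) ≤
      Polynomial.degreeLT ℂ w)
    (B : Matrix (Fin w) ι ℂ)
    (h : ∀ α ∈ R, ∀ b : Fin r, ∀ a : ι, ∑ m : Fin w, (α b).coeff m * B m a = 0) :
    B.rank + Module.finrank ℂ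
      ↥(⨆ b : Fin r, Submodule.map (LinearMap.proj b : (Fin r → ℂ[X]) →ₗ[ℂ] ℂ[X]) R) ≤ w := by
  classical
  set S := (⨆ b : Fin r, Submodule.map (LinearMap.proj b : (Fin r → ℂ[X]) →ₗ[ℂ] ℂ[X]) R)
    with hS
  -- the whole slot space is orthogonal to the columns of `B`
  have hS0 : ∀ q ∈ S, ∀ a : ι, ∑ m : Fin w, q.coeff m * B m a = 0 := fun q hq a =>
    hclR_stripR_orth_iSup R (fun m => B m a) (fun α hα b => h α hα b a) q hq
  -- the coefficient-vector map, injective on `S ≤ degreeLT w`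
  set π : ℂ[X] →ₗ[ℂ] (Fin w → ℂ) := LinearMap.pi (fun m : Fin w => Polynomial.lcoeff ℂ (m : ℕ))
    with hπ
  have hπapp : ∀ q : ℂ[X], ∀ m : Fin w, π q m = q.coeff m := fun q m => rfl
  have hinj : Function.Injective (π.domRestrict S) := by
    intro x y hxy
    apply Subtype.ext
    have hxy' : π (x : ℂ[X]) = π (y : ℂ[X]) := hxy
    have hsub : (x : ℂ[X]) - y ∈ Polynomial.degreeLT ℂ w := hR (sub_mem x.2 y.2)
    rw [Polynomial.mem_degreeLT, Polynomial.degree_lt_iff_coeff_zero] at hsub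
    rw [← sub_eq_zero]
    ext i
    rw [Polynomial.coeff_zero]
    by_cases hi : i < w
    · have hi' := congr_fun hxy' ⟨i, hi⟩
      rw [hπapp, hπapp] at hi'
      rw [Polynomial.coeff_sub, hi', sub_self]
    · exact hsub i (not_lt.mp hi)
  set W : Submodule ℂ (Fin w → ℂ) := LinearMap.range (π.domRestrict S) with hW
  have hWS : Module.finrank ℂ W = Module.finrank ℂ S := LinearMap.finrank_range_of_inj hinj
  -- the annihilating-functional map `Φ t = (v ↦ t ⬝ᵥ v)|_W`
  set Φ : (Fin w → ℂ) →ₗ[ℂ] Module.Dual ℂ W :=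
    W.dualRestrict ∘ₗ (dotProductEquiv ℂ (Fin w)).toLinearMap with hΦ
  have hsurj : Function.Surjective Φ :=
    Subspace.dualRestrict_surjective.comp (dotProductEquiv ℂ (Fin w)).surjective
  -- rank–nullity: `finrank W + finrank (ker Φ) = w`
  have hrank : Module.finrank ℂ W + Module.finrank ℂ (LinearMap.ker Φ) = w := by
    have h1 := LinearMap.finrank_range_add_finrank_ker Φ
    rwa [LinearMap.range_eq_top.mpr hsurj, finrank_top, Subspace.dual_finrank_eq,
      Module.finrank_fin_fun] at h1
  -- the column space of `B` lies in `ker Φ`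
  have hle : LinearMap.range B.mulVecLin ≤ LinearMap.ker Φ := by
    rintro _ ⟨v, rfl⟩
    rw [LinearMap.mem_ker]
    ext ⟨_, ⟨q, rfl⟩⟩
    rw [hΦ, LinearMap.comp_apply, Submodule.dualRestrict_apply, LinearMap.zero_apply]
    change B *ᵥ v ⬝ᵥ π (q : ℂ[X]) = 0
    have hzero : π (q : ℂ[X]) ᵥ* B = 0 := by
      funext a
      rw [Pi.zero_apply]
      exact hS0 q q.2 a
    rw [dotProduct_comm, Matrix.dotProduct_mulVec, hzero, zero_dotProduct]
  have h1 : B.rank ≤ Module.finrank ℂ (LinearMap.ker Φ) := Submodule.finrank_mono hle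
  omega

/-- Subadditivity of dimension over a finite supremum:
`finrank (s.sup U) ≤ Σ_{k ∈ s} finrank (U k)`. -/
theorem hclR_stripR_finrank_sup_le {ι V : Type*} [AddCommGroup V] [Module ℂ V]
    [FiniteDimensional ℂ V] (U : ι → Submodule ℂ V) (s : Finset ι) :
    Module.finrank ℂ ↥(s.sup U) ≤ ∑ k ∈ s, Module.finrank ℂ ↥(U k) := by
  classical
  induction s using Finset.induction_on with
  | empty => rw [Finset.sup_empty, Finset.sum_empty, finrank_bot]
  | insert a s ha ih =>
    rw [Finset.sup_insert, Finset.sum_insert ha]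
    exact (Submodule.finrank_add_le_finrank_add_finrank _ _).trans (Nat.add_le_add_left ih _)

/-- Subadditivity of dimension over a finite `⨆`: `finrank (⨆ k, U k) ≤ Σ_k finrank (U k)`. -/
theorem hclR_stripR_finrank_iSup_le {ι V : Type*} [Fintype ι] [AddCommGroup V] [Module ℂ V]
    [FiniteDimensional ℂ V] (U : ι → Submodule ℂ V) :
    Module.finrank ℂ ↥(⨆ k, U k) ≤ ∑ k, Module.finrank ℂ ↥(U k) := by
  rw [← Finset.sup_univ_eq_iSup]
  exact hclR_stripR_finrank_sup_le U Finset.univ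

/-- Every row index `n < N` lies in a strip: if `cut 0 = 0` and `cut (last p) = N` then there is
`k : Fin p` with `cut k.castSucc ≤ n < cut k.succ` (take the least `k₁` with `n < cut k₁`; it is
positive, and `k = k₁ - 1`). -/
theorem hclR_stripR_exists_strip {p N : ℕ} (cut : Fin (p + 1) → ℕ) (h0 : cut 0 = 0)
    (hN : cut (Fin.last p) = N) {n : ℕ} (hn : n < N) :
    ∃ k : Fin p, cut k.castSucc ≤ n ∧ n < cut k.succ := by
  classical
  set s : Finset (Fin (p + 1)) := Finset.univ.filter (fun k => n < cut k) with hs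
  have hlast : Fin.last p ∈ s := by
    rw [hs, Finset.mem_filter]
    exact ⟨Finset.mem_univ _, hN ▸ hn⟩
  have hne : s.Nonempty := ⟨_, hlast⟩
  have hk₁s : s.min' hne ∈ s := Finset.min'_mem s hne
  have hk₁lt : n < cut (s.min' hne) := (Finset.mem_filter.mp hk₁s).2
  have hk₁0 : s.min' hne ≠ 0 := by
    intro h0'
    rw [h0', h0] at hk₁lt
    exact Nat.not_lt_zero _ hk₁lt
  refine ⟨(s.min' hne).pred hk₁0, ?_, ?_⟩
  · by_contra hlt
    have hmem : ((s.min' hne).pred hk₁0).castSucc ∈ s :=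
      Finset.mem_filter.mpr ⟨Finset.mem_univ _, not_le.mp hlt⟩
    have hle := Fin.le_def.mp (Finset.min'_le s _ hmem)
    rw [Fin.val_castSucc, Fin.val_pred] at hle
    have hpos : 0 < ((s.min' hne) : ℕ) := Nat.pos_of_ne_zero fun h' => hk₁0 (Fin.ext h')
    omega
  · rw [Fin.succ_pred]
    exact hk₁lt

/-- Row cover (G2 (i)): the rows of `F` are rows of the strip blocks
`B_k := (F (cut k + m) a)_{m,a}`, so `rank F ≤ Σ_k rank B_k` (row spaces and subadditivity of
dimension over the supremum). -/
theorem hclR_stripR_rank_le_sum_blocks {r N p : ℕ} (cut : Fin (p + 1) → ℕ) (h0 : cut 0 = 0)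
    (hN : cut (Fin.last p) = N) (hle : ∀ k : Fin (p + 1), cut k ≤ N)
    (F : Matrix (Fin N) (Fin r) ℂ) :
    F.rank ≤ ∑ k : Fin p, (Matrix.of fun (m : Fin (cut k.succ - cut k.castSucc)) (a : Fin r) =>
      F ⟨cut k.castSucc + m, by have := hle k.succ; omega⟩ a).rank := by
  classical
  rw [Matrix.rank_eq_finrank_span_row]
  simp_rw [Matrix.rank_eq_finrank_span_row]
  refine (Submodule.finrank_mono (Submodule.span_le.mpr ?_)).trans
    (hclR_stripR_finrank_iSup_le _)
  rintro _ ⟨n, rfl⟩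
  obtain ⟨k, hk1, hk2⟩ := hclR_stripR_exists_strip cut h0 hN n.2
  refine Submodule.mem_iSup_of_mem k
    (Submodule.subset_span ⟨⟨(n : ℕ) - cut k.castSucc, by omega⟩, ?_⟩)
  funext a
  simp only [Matrix.row, Matrix.of_apply]
  congr 1
  ext
  dsimp only
  omega

/-! ## G3 — junk blocks vanish -/

set_option linter.unusedVariables false in
/-- **G3** (junk blocks vanish).  If the strip block of `F` (rows `c0 + m`, `m < wk`) is orthogonal
to the coefficient vectors of every slot projection of every relation at window `wk`, and the
window is junk for the polynomial frame (`S_{wk}` is all of `degreeLT wk`), then the strip block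
of `F` is zero: the annihilator of the block column is a submodule containing every slot, hence
all of `S_{wk} = degreeLT wk ∋ X^m`. -/
theorem hclR_strip_junk_block_zero : ∀ (r N : ℕ) (E F : Matrix (Fin N) (Fin r) ℂ) (c0 wk : ℕ) (hwk : c0 + wk ≤ N) (hOrth : ∀ α : Fin r → (Polynomial ℂ), α ∈ (LinearMap.ker (∑ c : Fin r, LinearMap.comp (Polynomial.lsum (fun (i : ℕ) => LinearMap.smulRight (LinearMap.id : ℂ →ₗ[ℂ] ℂ) (Polynomial.divX^[i] ((fun c' => (((Polynomial.degreeLT ℂ (N)).subtype ∘ₗ (Polynomial.degreeLTEquiv ℂ (N)).symm.toLinearMap : (Fin (N) → ℂ) →ₗ[ℂ] Polynomial ℂ)) (fun n => (E : Matrix (Fin N) (Fin _) ℂ) n c')) c : Polynomial ℂ))) : Polynomial ℂ →ₗ[ℂ] Polynomial ℂ) (LinearMap.proj c : (Fin r → Polynomial ℂ) →ₗ[ℂ] Polynomial ℂ)) ⊓ (Submodule.pi Set.univ (fun _ : Fin r => Polynomial.degreeLT ℂ (wk)) : Submodule ℂ (Fin r → Polynomial ℂ))) → ∀ b a : Fin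 r, ∑ m : Fin wk, (α b).coeff m * F ⟨c0 + m, by omega⟩ a = 0) (hjunk : (⨆ b : Fin r, Submodule.map (LinearMap.proj b : (Fin r → Polynomial ℂ) →ₗ[ℂ] Polynomial ℂ) (LinearMap.ker (∑ c : Fin r, LinearMap.comp (Polynomial.lsum (fun (i : ℕ) => LinearMap.smulRight (LinearMap.id : ℂ →ₗ[ℂ] ℂ) (Polynomial.divX^[i] ((fun c' => (((Polynomial.degreeLT ℂ (N)).subtype ∘ₗ (Polynomial.degreeLTEquiv ℂ (N)).symm.toLinearMap : (Fin (N) → ℂ) →ₗ[ℂ] Polynomial ℂ)) (fun n => (E : Matrix (Fin N) (Fin _) ℂ) n c')) c : Polynomial ℂ))) : Polynomial ℂ →ₗ[ℂ] Polynomial ℂ) (LinearMap.proj c : (Fin r → Polynomial ℂ) →ₗ[ℂ] Polynomial ℂ)) ⊓ (Submodule.pi Set.univ (fun _ : Fin r => Polynomial.degreeLT ℂ (wk)) : Submodule ℂ (Fin r → Polynomial ℂ)))) = Polynomial.degreeLT ℂ wk) (m : Fin wk) (a : Fin r), F ⟨c0 + m, by omega⟩ a = 0 := by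
  intro r N E F c0 wk hwk hOrth hjunk m a
  exact hclR_stripR_junk_aux _ (fun m : Fin wk => F ⟨c0 + m, by omega⟩ a)
    (fun α hα b => hOrth α hα b a) hjunk m

/-! ## G2 — the rank bound -/

set_option linter.unusedVariables false in
/-- **G2** (rank bound `rank F ≤ Σ_k cap_k`).  When the strips `[cut k, cut (k+1))` partition the
rows (`cut 0 = 0`, `cut p = N`) and each strip block of `F` is orthogonal to the coefficient
vectors of the slot projections of the relations at the strip's window `w_k = cut (k+1) − cut k`,
then `rank F ≤ Σ_k (w_k − finrank S_{w_k})`: `rank F ≤ Σ_k rank B_k` by the row cover, and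
`rank B_k + finrank S_{w_k} ≤ w_k` for every block.  (`hcut` is not needed.) -/
theorem hclR_strip_rank_le_sum_cap : ∀ (r N p : ℕ) (cut : Fin (p + 1) → ℕ) (hcut : Monotone cut) (h0 : cut 0 = 0) (hN : cut (Fin.last p) = N) (hle : ∀ k : Fin (p + 1), cut k ≤ N) (E F : Matrix (Fin N) (Fin r) ℂ) (hOrth : ∀ k : Fin p, ∀ α : Fin r → (Polynomial ℂ), α ∈ (LinearMap.ker (∑ c : Fin r, LinearMap.comp (Polynomial.lsum (fun (i : ℕ) => LinearMap.smulRight (LinearMap.id : ℂ →ₗ[ℂ] ℂ) (Polynomial.divX^[i] ((fun c' => (((Polynomial.degreeLT ℂ (N)).subtype ∘ₗ (Polynomial.degreeLTEquiv ℂ (N)).symm.toLinearMap : (Fin (N) → ℂ) →ₗ[ℂ] Polynomial ℂ)) (fun n => (E : Matrix (Fin N) (Fin _) ℂ) n c')) c : Polynomial ℂ))) : Polynomial ℂ →ₗ[ℂ] Polynomial ℂ) (LinearMap.proj c : (Fin r → Polynomial ℂ) →ₗ[ℂ] Polynomial ℂ)) ⊓ (Submodule.pi Set.univ (fun _ : Fin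 r => Polynomial.degreeLT ℂ ((cut k.succ - cut k.castSucc))) : Submodule ℂ (Fin r → Polynomial ℂ))) → ∀ b a : Fin r, ∑ m : Fin (cut k.succ - cut k.castSucc), (α b).coeff m * F ⟨cut k.castSucc + m, by have := hle k.succ; omega⟩ a = 0), F.rank ≤ ∑ k : Fin p, ((cut k.succ - cut k.castSucc) - Module.finrank ℂ ↥((⨆ b : Fin r, Submodule.map (LinearMap.proj b : (Fin r → Polynomial ℂ) →ₗ[ℂ] Polynomial ℂ) (LinearMap.ker (∑ c : Fin r, LinearMap.comp (Polynomial.lsum (fun (i : ℕ) => LinearMap.smulRight (LinearMap.id : ℂ →ₗ[ℂ] ℂ) (Polynomial.divX^[i] ((fun c' => (((Polynomial.degreeLT ℂ (N)).subtype ∘ₗ (Polynomial.degreeLTEquiv ℂ (N)).symm.toLinearMap : (Fin (N) → ℂ) →ₗ[ℂ] Polynomial ℂ)) (fun n => (E : Matrix (Fin N) (Fin _) ℂ) n c')) c : Polynomial ℂ))) : Polynomial ℂ →ₗ[ℂ] Polynomial ℂ) (LinearMap.proj c : (Fin r → Polynomial ℂ) →ₗ[ℂ] Polynomial ℂ)) ⊓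 (Submodule.pi Set.univ (fun _ : Fin r => Polynomial.degreeLT ℂ ((cut k.succ - cut k.castSucc))) : Submodule ℂ (Fin r → Polynomial ℂ)))))) := by
  intro r N p cut hcut h0 hN hle E F hOrth
  refine (hclR_stripR_rank_le_sum_blocks cut h0 hN hle F).trans (Finset.sum_le_sum fun k _ => ?_)
  apply Nat.le_sub_of_add_le
  refine hclR_stripR_block_rank_add_le _ ?_ _ (fun α hα b a => hOrth k α hα b a)
  -- `S_w ≤ degreeLT w`
  refine iSup_le fun b => ?_
  rintro _ ⟨α, hα, rfl⟩
  exact hα.2 b (Set.mem_univ b)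

end Summit.MatrixMultiplication.MatrixMultiplication.Theorems
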